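import Summits.CriticalPhenomena.PercolationContinuityZ3.Theorems.Transplant.SkelFrmFrom1Normalise
import Summits.CriticalPhenomena.PercolationContinuityZ3.Theorems.Transplant.SkelFrmQuasi1ClosurePx
import Summits.CriticalPhenomena.PercolationContinuityZ3.Theorems.Transplant.PlanarSkeletonFrmQuasiDefs
import Summits.CriticalPhenomena.PercolationContinuityZ3.Theorems.Transplant.PlanarSkeletonFrmQuasiReflect
import HarnessLib

/-!
# GEN-Q PORT (WAVE-Q table v0.8 section 2, row G246, U-level ?; captain R-6/R-7 2026-08-27: carrier token swap `PlanarSkeletonFrmFrom ↦ PlanarSkeletonFrmQuasi`)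
# of the tree module «Transplant/SkelFrmFrom1NormalisePx» (sha256 3e8a253a984cac60…) onto the quasi-step carrier `PlanarSkeletonFrmQuasi` (p507026): «SkelFrmQuasi1NormalisePx»

ORIGINAL TITLE: 

builds on p205010 (kernel theorem, internal audit signed; external expert review pending) — nothing in this file uses p205010; NOTHING is claimed about any open node
((N3-b), the end state).  Lane `prim-bschramm`, seat `prim-bschramm-gen-1` (gen 4; binder-wave captain).  Helper file (`--supports stmt-CriticalPhenomena-4575 --as helper`).
PORT RULES (U-wave r1–r4 re-used, GEN-Q hunk classes of p3-g29 #6136): declaration order, names and proof texts are those of «SkelFrmFrom1NormalisePx», byte-identical except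
(i) the carrier token `PlanarSkeletonFrmFrom ↦ PlanarSkeletonFrmQuasi` in binders, `namespace`/`end` lines and qualified names (module names `SkelFrmFrom… ↦ SkelFrmQuasi…`
in imports of already-ported rows); (ii) `Φ.step ↦ Φ.qstep` with the called Steps lemma replaced by its `…Q`/`_q` twin and the cost `Φ.M` threaded (none in this file unless
listed below); (iii) `Φ.cyl_connected ↦ Φ.cyl_reach` readers (none unless listed); (iv) graph-ball radii / window floors ×`Φ.M` (none unless listed).  Carrier-free
residents stay imported/exported from the original «SkelFrm1NormalisePx» exactly as in the FrmFrom port.  Docstrings and citations are the original's.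

-/

noncomputable section

open MeasureTheory ProbabilityTheory
open scoped ENNReal Classical

namespace Summit.CriticalPhenomena.PercolationContinuityZ3.Theorems.Transplant

open Literature.Probability.Percolation Literature.Probability.LatticeModels SimpleGraph KNLevels
open Literature.Barriers.CriticalPhenomena (HasExponentialGrowth)

namespace PlanarSkeletonFrmQuasi

variable {V : Type} {G : SimpleGraph V} [G.LocallyFinite]

/-- **THE CLOSURE OVER THE NORMALISED RECORD AT ONE BASE TYPE (multi-type carrier), pointwise.**  Let `Φ : PlanarSkeletonFrmQuasi G`, `t ∈ Φ.types`, `D` a seed-floor shift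
(the proxies' radius in U_s), `0 < p < 1` with a.s. uniqueness, Φ2 (`hC`) and `θ_t(p) > 0`.  Suppose that for each of the four REFLECTED skeletons `Φ.reflect s` the instance
(`hB s`) names `0 < δI < 1` and `m₀`; receives a record WITH SELECTORS `O : OutNS V` satisfying `O.FactsNS (Φ.reflect s).frame hC' (max m₀ D) t` (`hC'` = Φ2 of the reflected
skeleton) — in particular the served quadrant at every selected pair is `(E, N)` and the orientation is constant there; returns admissible finite lists `Sz`, `SMn`; and at every
`q ∈ [p/2, p]` where the oriented family over `indexNQ {t} Sz SMn (sgQ O.qd O.qdT O.ori)` (chart `(Φ.reflect s).φ`) holds with accuracy `δI` and Φ2 of `Φ.reflect s` holds,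
proves `θ_t(q) > 0`.  Then some `q < p` has `θ_t(q) > 0`.  (Proof: from `drop_of_stepI_frQ_at` by the quadrant normalisation of «SkelFrm1Normalise» — cofinal colour,
`Φ.reflect s`, `DataNS.ofSel (·.reflectRec s)`, covariance; `δI`/`m₀` are the min/max over the four sign vectors.  The U closure `samePDropOfSkeletonFrmFrom₁_of_stepI_outNS`
is the case `types = {t}`, `D = 0`.)
[cite: KozmaNitzan2024, §1 p. 2 (approach 1); §4 Theorem 6 (pp. 25–31), p. 16 (Lemma 8), p. 17] [cite: MartineauTassion2017, §3.2 Lemma 3.2, §3.3 Lemma 3.7] -/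
theorem drop_of_stepI_outNS_at [DecidableEq V] [Countable V] (Φ : PlanarSkeletonFrmQuasi G) {t : V} (ht : t ∈ Φ.types) (D : ℕ)
    (p : unitInterval) (hp0 : 0 < (p : ℝ)) (hp1 : (p : ℝ) < 1) (hU : ∀ᵐ ω ∂bondPercolation G p, numInfiniteClusters ω ≤ 1) (hC : Φ.CylSubcritical p)
    (hθ : 0 < theta G t p)
    (hB : ∀ s : Fin 2 → ℤˣ, ∃ (δI : ℝ) (m₀ : ℕ), 0 < δI ∧ δI < 1 ∧
      ∀ O : Skelφ.StepI.OutNS V, O.FactsNS (G := G) (Φ.reflect s).frame ((Φ.reflect_cylSubcritical_iff s p).2 hC) (max m₀ D) t →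
        ∃ (Sz : Finset ℕ) (SMn : Finset (ℕ × ℕ)), (∀ M ∈ Sz, O.D.M₀ ≤ M) ∧ (∀ q ∈ SMn, O.D.M₀ ≤ q.1 ∧ O.D.n₁ q.1 ≤ q.2) ∧
          ∀ q : unitInterval, (p : ℝ) / 2 ≤ q → (q : ℝ) ≤ p →
            (∀ i ∈ Skelφ.StepI.indexNQ {t} Sz SMn (Skelφ.StepI.sgQ O.qd O.qdT O.ori),
              1 - δI < (bondPercolation G q).real (Skelφ.StepI.eventO G (Φ.reflect s).φ O.D.toDataN O.DT.toDataN O.ori i)) →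
            (Φ.reflect s).CylSubcritical q → 0 < theta G t q) :
    ∃ q : unitInterval, (q : ℝ) < p ∧ 0 < theta G t q := by
  -- the hypothesis at each of the four reflected skeletons, up front
  choose δIf m₀f hδIf0 hδIf1 hrest using hB
  obtain ⟨s₀, -, hs₀⟩ := Finset.exists_min_image Finset.univ δIf ⟨1, Finset.mem_univ _⟩
  refine drop_of_stepI_frQ_at Φ ht D p hp0 hp1 hU hC hθ ⟨δIf s₀, Finset.univ.sup m₀f, hδIf0 s₀, hδIf1 s₀, ?_⟩
  intro D₀ DT qd qdT ori hk₀ hk₁ hkM hR hΛ e1 e2 e3 e4 e5 hgeom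
  -- admissibility and colour; a cofinal colour
  let adm : ℕ → ℕ → Prop := fun M n => D₀.M₀ ≤ M ∧ D₀.n₁ M ≤ n
  let col : ℕ → ℕ → Bool × (ℤˣ × ℤˣ) := fun M n => (ori t M n, if ori t M n = true then qd t M n else qdT t M n)
  have hadm : Skelφ.ScaleSel.AdmCofinal adm D₀.M₀ := fun M hM N => ⟨max N (D₀.n₁ M), le_max_left _ _, hM, le_max_right _ _⟩
  obtain ⟨c, hc⟩ := Skelφ.ScaleSel.exists_colourCofinal hadm col
  -- the normalising signs and the reflected skeleton
  let s : Fin 2 → ℤˣ := if c.1 = true then ![c.2.1, c.2.2] else ![c.2.2, c.2.1]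
  set Ψ : PlanarSkeletonFrmQuasi G := Φ.reflect s with hΨ
  have hCΨ : Ψ.CylSubcritical p := (Φ.reflect_cylSubcritical_iff s p).2 hC
  -- the record with selectors of the reflected skeleton
  let Ds : Skelφ.StepI.DataNS V := Skelφ.StepI.DataNS.ofSel (D₀.reflectRec s) hc
  let DTs : Skelφ.StepI.DataNS V := Skelφ.StepI.DataNS.ofSel (DT.reflectRec s) hc
  let O : Skelφ.StepI.OutNS V := ⟨Ds, DTs, ori, Skelφ.StepI.qdR s qd, Skelφ.StepI.qdTR s qdT⟩
  -- its facts
  have hcol : ∀ M₁ N, ori t (Ds.sM M₁) (Ds.sN M₁ N) = c.1 ∧ (if ori t (Ds.sM M₁) (Ds.sN M₁ N) = true then qd t (Ds.sM M₁) (Ds.sN M₁ N)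
      else qdT t (Ds.sM M₁) (Ds.sN M₁ N)) = c.2 := fun M₁ N => by
    have := (Skelφ.StepI.DataNS.ofSel_adm_col (D₀.reflectRec s) hc M₁ N).2
    exact ⟨congrArg Prod.fst this, congrArg Prod.snd this⟩
  have hm₀ : max (m₀f s) D ≤ D₀.k :=
    (max_le_max (Finset.le_sup (f := m₀f) (Finset.mem_univ s)) le_rfl).trans hk₀
  have hfacts : O.FactsNS (G := G) Ψ.frame hCΨ (max (m₀f s) D) t := by
    refine ⟨⟨hm₀, hk₁, hkM, ?_, ?_, e1, e2, e3, e4, e5, fun M hM n hn => ?_⟩, ?_, ?_, ?_, ⟨rfl, rfl⟩⟩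
    · show D₀.R = Skelφ.fatRadius Ψ.frame _
      rw [hR]; exact (funext (Skelφ.fatRadius_reflφ (φ := Φ.φ) (types := Φ.types) s Φ.frame hC Ψ.frame hCΨ)).symm
    · show D₀.Λ = Skelφ.fatSeq Ψ.frame _
      rw [hΛ]; exact (Skelφ.fatSeq_reflφ (φ := Φ.φ) (types := Φ.types) s Φ.frame hC Ψ.frame hCΨ).symm
    · obtain ⟨ha, hb⟩ := hgeom M hM n hn
      refine ⟨fun ho => ⟨Skelφ.StepI.eqGeom_reflφ s (ha ho).1, ?_⟩, fun ho => ⟨Skelφ.StepI.eqGeom_reflφ_tr s (hb ho).1, ?_⟩⟩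
      · show ((s 0 : ℤ) * (s 1 : ℤ) * D₀.hgt t M n).natAbs ≤ 10 * n
        rw [Skelφ.natAbs_reflHgt]; exact (ha ho).2
      · show ((s 0 : ℤ) * (s 1 : ℤ) * DT.hgt t M n).natAbs ≤ 10 * n
        rw [Skelφ.natAbs_reflHgt]; exact (hb ho).2
    · intro M₁ N
      exact (Skelφ.StepI.DataNS.ofSel_adm_col (D₀.reflectRec s) hc M₁ N).1
    · intro M₁ N
      obtain ⟨ho, hq⟩ := hcol M₁ N
      show (if ori t (Ds.sM M₁) (Ds.sN M₁ N) = true then Skelφ.StepI.qdR s qd t (Ds.sM M₁) (Ds.sN M₁ N)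
        else Skelφ.StepI.qdTR s qdT t (Ds.sM M₁) (Ds.sN M₁ N)) = (1, 1)
      obtain ⟨b, σ₀, σ₁⟩ := c
      simp only at ho hq
      cases b
      · rw [ho] at hq ⊢
        simp only [Bool.false_eq_true, ↓reduceIte] at hq ⊢
        simp only [Skelφ.StepI.qdTR, hq, s, Bool.false_eq_true, ↓reduceIte, Matrix.cons_val_zero, Matrix.cons_val_one,
          Skelφ.StepI.units_mul_self', Prod.mk_one_one]
      · rw [ho] at hq ⊢
        simp only [↓reduceIte] at hq ⊢
        simp only [Skelφ.StepI.qdR, hq, s, ↓reduceIte, Matrix.cons_val_zero, Matrix.cons_val_one, Skelφ.StepI.units_mul_self', Prod.mk_one_one]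
    · intro M₁ N M₁' N'
      show ori t (Ds.sM M₁) (Ds.sN M₁ N) = ori t (Ds.sM M₁') (Ds.sN M₁' N')
      rw [(hcol M₁ N).1, (hcol M₁' N').1]
  -- the residues' answer for the reflected skeleton, transported back
  obtain ⟨Sz, SMn, hSz, hSMn, hend⟩ := hrest s O hfacts
  refine ⟨Sz, SMn, hSz, hSMn, fun q hq1 hq2 hfam hCq => hend q hq1 hq2 ?_ ((Φ.reflect_cylSubcritical_iff s q).2 hCq)⟩
  have hmin : δIf s₀ ≤ δIf s := hs₀ s (Finset.mem_univ _)
  intro i hi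
  have := Skelφ.StepI.family_reflφ (G := G) (φ := Φ.φ) (types := ({t} : Finset V)) s D₀ DT qd qdT ori (μ := bondPercolation G q) hfam i hi
  exact lt_of_le_of_lt (by linarith) this

end PlanarSkeletonFrmQuasi

end Summit.CriticalPhenomena.PercolationContinuityZ3.Theorems.Transplant

end
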